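import Mathlib

/-!
# T5SemisimpleQuotient — kernel witnesses for route/T5-CHECK-N3-p8.md v4 §8 (blind cell pub-hodge-repro2)

The two module-theoretic steps (r2)–(r3) of route/T5-N3-route-2.md v0.4 §N3.11.4, the reading of
Gan–Takeda's (HD) — «dim Hom_{H(V)}(θ(π), θ(π′)) ≤ δ_{π,π′}» for θ(π) the maximal SEMISIMPLE
quotient of the finite-length Θ(π) (paper:arxiv-1407.1995 p0003 ll. 21–29, 42–47) — as «at most
one irreducible partner of π».

* (r3) `isSimpleModule_or_subsingleton_of_endo_scalar`: a semisimple module all of whose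
  endomorphisms are scalars (the content of «dim End ≤ 1» at π′ = π) is zero or simple — two
  non-zero complementary summands would give a non-scalar idempotent endomorphism.
* (r2) `radical_le_ker` / `exists_factor_radical`: every surjection onto a simple module factors
  through the quotient by the radical `radical R M = ⨅ coatoms` (the maximal semisimple
  quotient of a finite-length module is `M ⧸ radical R M`; only the inclusion «radical ≤ every
  maximal submodule» is used, so finite length is not assumed here);
  `ker_eq_radical_of_isCoatom` / `simple_quotients_equiv_of_isCoatom_radical`: if that quotient is
  simple (= the radical is a coatom), all simple quotients of `M` are isomorphic — «at most one
  partner» once (r3) has made θ(π) irreducible.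
* `ker_eq_bot_of_endo_scalar`: the combination for a semisimple module with scalar endomorphisms —
  every surjection onto a simple module is an isomorphism.

Nothing about representations, Weil representations or theta correspondence is asserted; the
groups, Θ(π), θ(π) and Kudla's finite-length theorem stay in the prose.
-/

namespace Summit.Ventures.HodgeRepro2.T5SemisimpleQuotient

section Radical

variable {R M : Type*} [Ring R] [AddCommGroup M] [Module R M]

/-- The radical of a module: the intersection of its maximal submodules (coatoms). The maximal
semisimple quotient of a finite-length module is `M ⧸ radical R M`. -/
def radical (R M : Type*) [Ring R] [AddCommGroup M] [Module R M] : Submodule R M :=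
  ⨅ (N : Submodule R M) (_ : IsCoatom N), N

/-- A surjection onto a simple module has a coatom as its kernel. -/
theorem isCoatom_ker_of_surjective' {S : Type*} [AddCommGroup S] [Module R S] [IsSimpleModule R S]
    (f : M →ₗ[R] S) (hf : Function.Surjective f) : IsCoatom (LinearMap.ker f) := by
  rw [← isSimpleModule_iff_isCoatom]
  exact IsSimpleModule.congr (f.quotKerEquivOfSurjective hf)

/-- (r2) The radical lies in the kernel of every surjection onto a simple module. -/
theorem radical_le_ker {S : Type*} [AddCommGroup S] [Module R S] [IsSimpleModule R S]
    (f : M →ₗ[R] S) (hf : Function.Surjective f) : radical R M ≤ LinearMap.ker f :=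
  iInf₂_le (LinearMap.ker f) (isCoatom_ker_of_surjective' f hf)

/-- (r2) Hence every surjection onto a simple module factors through `M ⧸ radical R M` — «an
irreducible quotient factors through the maximal semisimple quotient». -/
theorem exists_factor_radical {S : Type*} [AddCommGroup S] [Module R S] [IsSimpleModule R S]
    (f : M →ₗ[R] S) (hf : Function.Surjective f) :
    ∃ g : (M ⧸ radical R M) →ₗ[R] S, g ∘ₗ (radical R M).mkQ = f :=
  ⟨_, Submodule.liftQ_mkQ _ f (radical_le_ker f hf)⟩

/-- If the radical is a coatom (the maximal semisimple quotient is simple), it IS the kernel of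
every surjection onto a simple module. -/
theorem ker_eq_radical_of_isCoatom (hrad : IsCoatom (radical R M)) {S : Type*} [AddCommGroup S]
    [Module R S] [IsSimpleModule R S] (f : M →ₗ[R] S) (hf : Function.Surjective f) :
    LinearMap.ker f = radical R M := by
  have hle : radical R M ≤ LinearMap.ker f := radical_le_ker f hf
  rcases hle.lt_or_eq with hlt | heq
  · exact absurd (hrad.2 _ hlt) (isCoatom_ker_of_surjective' f hf).1
  · exact heq.symm

/-- «At most one partner»: if the radical is a coatom, any two simple quotients are isomorphic. -/
theorem simple_quotients_equiv_of_isCoatom_radical (hrad : IsCoatom (radical R M))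
    {S₁ S₂ : Type*} [AddCommGroup S₁] [Module R S₁] [AddCommGroup S₂] [Module R S₂]
    [IsSimpleModule R S₁] [IsSimpleModule R S₂]
    (f : M →ₗ[R] S₁) (g : M →ₗ[R] S₂) (hf : Function.Surjective f) (hg : Function.Surjective g) :
    Nonempty (S₁ ≃ₗ[R] S₂) :=
  ⟨(f.quotKerEquivOfSurjective hf).symm.trans
    ((Submodule.quotEquivOfEq _ _
      ((ker_eq_radical_of_isCoatom hrad f hf).trans (ker_eq_radical_of_isCoatom hrad g hg).symm)).trans
      (g.quotKerEquivOfSurjective hg))⟩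

end Radical

section Semisimple

variable {k R M : Type*} [Field k] [Ring R] [AddCommGroup M] [Module k M] [Module R M]

/-- (r3) A semisimple module whose `R`-endomorphisms are all `k`-scalars is zero or simple: a
proper non-zero submodule `N` has a complement `N'`, and the projection onto `N` along `N'` is an
endomorphism that is `1` on `N ≠ 0` and `0` on `N' ≠ 0`, hence not a scalar. -/
theorem isSimpleModule_or_subsingleton_of_endo_scalar [IsSemisimpleModule R M]
    (h : ∀ φ : M →ₗ[R] M, ∃ c : k, ∀ x, φ x = c • x) :
    IsSimpleModule R M ∨ Subsingleton M := by
  by_cases hM : Subsingleton M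
  · exact Or.inr hM
  left
  have hnt : Nontrivial M := not_subsingleton_iff_nontrivial.mp hM
  have hnt' : Nontrivial (Submodule R M) := (Submodule.nontrivial_iff R).mpr hnt
  rw [isSimpleModule_iff]
  refine ⟨fun N => ?_⟩
  by_contra hN
  simp only [not_or] at hN
  obtain ⟨hN₁, hN₂⟩ := hN
  obtain ⟨N', hNN'⟩ := exists_isCompl N
  -- the projection onto `N` along `N'`
  have hsc := h (N.projection N' hNN')
  obtain ⟨c, hc⟩ := hsc
  -- a non-zero vector of `N`
  obtain ⟨x, hxN, hx0⟩ := (Submodule.ne_bot_iff N).mp hN₁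
  -- `N' ≠ ⊥`, else `N = ⊤`
  have hN'0 : N' ≠ ⊥ := by
    intro hb
    apply hN₂
    have := hNN'.sup_eq_top
    rwa [hb, sup_bot_eq] at this
  obtain ⟨y, hyN', hy0⟩ := (Submodule.ne_bot_iff N').mp hN'0
  -- on `N` the projection is the identity, so `c = 1`
  have hx : c • x = x := by
    rw [← hc x, Submodule.projection_apply_of_mem_left hNN' hxN]
  have hc1 : c = 1 := by
    have : (c - 1) • x = 0 := by rw [sub_smul, one_smul, hx, sub_self]
    rcases smul_eq_zero.mp this with h1 | h1
    · exact sub_eq_zero.mp h1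
    · exact absurd h1 hx0
  -- on `N'` the projection is zero, so `y = c • y = 0`
  have hy : c • y = 0 := by
    rw [← hc y, Submodule.projection_apply_of_mem_right hNN' hyN']
  rw [hc1, one_smul] at hy
  exact hy0 hy

/-- The combination (r2)+(r3): for a semisimple module with scalar endomorphisms, every
surjection onto a simple module is injective (its kernel is `⊥`). -/
theorem ker_eq_bot_of_endo_scalar [IsSemisimpleModule R M]
    (h : ∀ φ : M →ₗ[R] M, ∃ c : k, ∀ x, φ x = c • x)
    {S : Type*} [AddCommGroup S] [Module R S] [IsSimpleModule R S]
    (f : M →ₗ[R] S) (hf : Function.Surjective f) : LinearMap.ker f = ⊥ := by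
  rcases isSimpleModule_or_subsingleton_of_endo_scalar (k := k) h with hs | hs
  · -- simple: the kernel is a proper submodule of a simple module
    have hco := isCoatom_ker_of_surjective' f hf
    rcases IsSimpleOrder.eq_bot_or_eq_top (LinearMap.ker f) with h1 | h1
    · exact h1
    · exact absurd h1 hco.1
  · exact Subsingleton.elim _ _

end Semisimple

end Summit.Ventures.HodgeRepro2.T5SemisimpleQuotient
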